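import Literature.IUT.HodgeArakelov.LabelClassesOfCuspsCor24iOfSpecialFibreComap
import Literature.IUT.HodgeArakelov.LabelClassesOfCuspsCor24iGenuine
import Literature.IUT.HodgeArakelov.StableCurveAgreementPiDictionaryGenuine
import HarnessLib

/-!
# [IUTchII] Cor 2.4 (i)′ AT THE GENUINE PAIR with the dictionary hypothesis replaced by «`Π_{v□} = Π_v ∩ Π^tp_{X̲_v,ℍ_□}`»

S. Mochizuki, *Inter-universal Teichmüller Theory II*, kurims manuscript (Dec. 2020), §2, Def 2.3 (i) p. 67 («`Π^±_{v▶} := N_{Π^±_v}(Π_{v▶})` …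
[cf. [IUTchI], Corollary 2.3, (iv)]»), Def 2.3 (iv) p. 68 (`Π_{v•t} ⊆ Π_{v▶}` the decomposition groups of `Γ_{•t} ⊆ Γ^▶_X`), Cor 2.4 (i) pp. 69–71
(proof p. 70: «where ℍ = Γ_□»); *Inter-universal Teichmüller Theory I* (May 2020), §2, Cor 2.3 (iii)(iv)(v) pp. 47–48, Prop 2.4 (i) p. 50
[cite: Mochizuki2012, II Def 2.3 (i)(iv) pp.67–68, II Cor 2.4 (i) pp.69–71; I Cor 2.3 (iii)(iv)(v) pp.47–48, I Prop 2.4 (i) p.50] (D-0012 claim key,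
status disputed; every printed statement of the series is a HYPOTHESIS named by the tree's predicates — nothing of the series is asserted).
abc-iut cell, seat abc-iut-w5-d132 (gen 5); node **IUTchII:Cor2.4(i)** (CONE-BOARD claimant abc-iut-w4-d012) — by-name sequel to abc-iut-w4-d012's
`cor24_i'_ofPiCHat_ofSpecialFibre` (p437345) and this seat's `cor24_i_ofSpecialFibre_comap` (p438242).  PROOF-ONLY (no `def`/`structure`/`instance`).

THE POINT.  abc-iut-w4-d012's genuine-pair theorem proves the decl of record `Cor24_i' Dec (ofPiCHat …) Cu Ld I` modulo, per admissible `Π_{v□}`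
(`Cor24_family`: `Π_{v▶} = Dec.Ptri`, `Π_{v•t} = Ld.Pbt t`), a sub-graph `ℍ'` TOGETHER WITH «the Δ-dictionary identity through `A.eHat`» — a
hypothesis about the (existentially produced) agreement isomorphism.  By this seat's Def 2.3 (i) dictionary theorem (`subgraphDictionary_comap`,
p437206: «`Π^±_{v▶} = N_{Π^±_v}(Π_{v▶}) = Π^tp_{X,ℍ}` [cf. [IUTchI] Cor 2.3 (iv)]»), that hypothesis may be REPLACED by the `eHat`-FREE identification
**«`Π_{v□} = incl⁻¹(plainIso⁻¹ Π^tp_{X̲_v,ℍ_□})`»** — i.e. «`Π_{v□}` IS the decomposition subgroup of `ℍ_□ = Γ_□` in `Π_v` cut out by the datum» (print: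
«where ℍ = Γ_□», p. 70), a statement about abc-iut-L6-t1's `SubgraphDecomposition` and the special-fibre datum ALONE (`plainIso` = abc-iut-L6-t19's
identification `Π^tp_{X̲_v}(P) ⥲ Π^tp_{X̲_v}` of the tower of record) — plus the L5 NODES [IUTchI] Cor 2.3 (iii), (iv) of the `ℍ_□`-datum.

* **`PlusMinusTower.cor24_i'_ofPiCHat_ofSpecialFibre_comap`** — at abc-iut-L6-t19's GENUINE tower `ofPiCHat` and abc-iut-L5's GENUINE datum of `X̲_v`
  (setting and binders of p433029 / p437345 verbatim): ∃ `Cu` `A` (bicontinuous, `eHat ∘ emb = ιX ∘ plainIso`, level clause) such that for every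
  labelled decomposition `Ld` and every `Π_v`-cuspidal `I ⊆ Δ̂^cor_v`, `Cor24_i' Dec (ofPiCHat …) Cu Ld I` HOLDS modulo the NAMED RESIDUAL:
  [IUTchI] Prop 2.4 (i) of `X̲_v`'s datum; per admissible `Π_{v□}` a sub-graph `Π^tp_{ℍ'}` (with `Π̂_{ℍ'}` its closure) such that
  **`Π_{v□} = incl⁻¹(plainIso⁻¹ Π^tp_{X̲_v,ℍ'})`** and [IUTchI] Cor 2.3 (iii), (iv), (v) of its datum hold (under its `Cor23Hyp`); the open-subgroup
  step (B) (`h23vi`, GAP-LEDGER G-w4d012-2).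

HONEST LABEL: GENUINE on both sides modulo the binders `hZ`, `hN`, `hDopen`, the special-fibre DATA of `X̲_v`; the identification
«`Π_{v□} = incl⁻¹(plainIso⁻¹ Π^tp_{X̲_v,ℍ_□})`» is the MERGE identification of plan/L6/MERGE-MAP.md (decomposition groups named on the `Π^tp_{X̲̲_v}`
side by [IUTchII] Prop 2.2 (i) versus on the `X̲_v` side by [IUTchI] Cor 2.3) — an explicit HYPOTHESIS here, not claimed.  Nothing of the series is
asserted; no side taken on [IUTchIII] Cor 3.12.
-/

noncomputable section

namespace Literature.IUT.HodgeArakelov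

open Literature.AnabelianGeometry.EtaleTheta Literature.AnabelianGeometry.SemiGraphs Literature.IUT.HodgeTheaters
open scoped Pointwise

namespace PlusMinusTower

variable {p : ℕ} [Fact p.Prime] {M : MuTwoSetting p} (e : M.CLevelData)
  {E : M.toThetaSetting.EtaleThetaData} {l : ℕ} (C : E.DoubleUnderline l) {N : ℕ+}
  (μ : M.toThetaSetting.CyclotomeMod l N) (hC : M.toThetaSetting.Compat) (hS : M.toThetaSetting.Sec2Hyps)
  (hl : l.Prime) (hp2 : p ≠ 2) (hpl : p ≠ l) (hζ : ∃ ζ : M.toThetaSetting.K, IsPrimitiveRoot ζ (4 * l))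
  {η : (C.thetaEnvData μ hC hS).PiYdd → MuN p N} (hη : η ∈ (C.thetaEnvData μ hC hS).thetaCocycles)
  (hZ : Thm16Sub.KerToZIsCompactlyGenerated M.toThetaSetting) (hN : (C.Huu.subgroupOf (M.GtpXu l)).Normal)
  {P : TopGroup.{0}} (T : TemperedCoverings (BadPlaceSetting.ofUnderline C μ hC hS hl hp2 hpl hζ hη) P)

/-- **[IUTchII] Cor 2.4 (i)′ AT THE GENUINE PAIR, dictionary hypothesis replaced by «`Π_{v□} = Π_v ∩ Π^tp_{X̲_v,ℍ_□}`».**  At abc-iut-L6-t19's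
GENUINE `±`-tower `ofPiCHat` and abc-iut-L5's GENUINE [IUTchI] §2 datum `ofSpecialFibre` of `X̲_v` (binders of p433029/p437345): there are the transported
cuspidal datum `Cu` and an agreement `A` (`IsHomeomorph A.eHat`, `eHat ∘ emb = ιX ∘ plainIso`, level clause) such that for every labelled decomposition
`Ld` of `Dec` and every `Π_v`-cuspidal `I ⊆ Δ̂^cor_v` the decl of record `Cor24_i' Dec (ofPiCHat …) Cu Ld I` HOLDS, MODULO: [IUTchI] Prop 2.4 (i) of the
datum (`Prop24i`); for each admissible `Π_{v□}` a sub-graph `Π^tp_{ℍ'} = TpH'` (with `Π̂_{ℍ'}` its closure, `hH'`) such that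
`Π_{v□} = incl⁻¹(plainIso⁻¹ Π^tp_{X̲_v,ℍ'})` and [IUTchI] Cor 2.3 (iii), (iv), (v) of its datum under its `Cor23Hyp` (L5 nodes BY NAME); and the
open-subgroup step (B) `h23vi` (G-w4d012-2).  DISCHARGED (in addition to p437345's list): the Δ-dictionary identity, by `cor24_i_ofSpecialFibre_comap`.
PROVED. ([IUTchII] Cor 2.4 (i), kurims pp.69–71) [claim: Mochizuki2012, status: disputed] -/
theorem cor24_i'_ofPiCHat_ofSpecialFibre_comap [(M.GtpXu l).FiniteIndex] [FiniteDimensional ℚ_[p] M.K]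
    (hDopen : ∀ (x : M.toTemperedCurve.Pt) (g : M.toTemperedCurve.PiTemp),
      IsOpen (M.toTemperedCurve.aug '' ((M.toTemperedCurve.decompOfOpenAt (M.GtpXu l) x g).map (M.GtpXu l).subtype :
        Set M.toTemperedCurve.PiTemp)))
    (d : (M.toTemperedCurve.ofOpenSubgroup (M.GtpXu l) (M.toThetaSetting.isOpen_GtpXu l) M.K (range_aug_GtpXu_eq_GK C) hDopen).GroupLevelData)
    (Sf : SpecialFibreData ((M.toTemperedCurve.ofOpenSubgroup (M.GtpXu l) (M.toThetaSetting.isOpen_GtpXu l) M.K (range_aug_GtpXu_eq_GK C) hDopen).toTemperedArithmeticGroup d))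
    (h36 : Sf.Gc.Prop36Hypotheses) (Sigma SigmaHat : Set ℕ) (hsub : Sigma ⊆ SigmaHat) (hne : Sigma.Nonempty)
    (hprime : ∀ q ∈ SigmaHat, q.Prime) (hp : p ∉ Sigma) (TpH : Subgroup Sf.chart.G)
    (HatH : Subgroup (TemperedGraphGroupData.exists_completion_of_prop36 Sf.Gc h36 Sf.chart).choose)
    (hle : TpH.map (TemperedGraphGroupData.exists_completion_of_prop36 Sf.Gc h36 Sf.chart).choose_spec.choose.toMonoidHom ≤ HatH)
    (cuspMeetsH : {x : (M.toTemperedCurve.ofOpenSubgroup (M.GtpXu l) (M.toThetaSetting.isOpen_GtpXu l) M.K (range_aug_GtpXu_eq_GK C) hDopen).Pt // (M.toTemperedCurve.ofOpenSubgroup (M.GtpXu l) (M.toThetaSetting.isOpen_GtpXu l) M.K (range_aug_GtpXu_eq_GK C) hDopen).IsCusp x} → Prop)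
    {D : EtaleThetaData (BadPlaceSetting.ofUnderline C μ hC hS hl hp2 hpl hζ hη).toThetaSetting P}
    (Dec : SubgraphDecomposition (BadPlaceSetting.ofUnderline C μ hC hS hl hp2 hpl hζ hη) T D) :
    ∃ (Cu : CuspidalInertiaData (ofPiCHat e C μ hC hS hl hp2 hpl hζ hη hZ hN T))
      (A : StableCurveAgreement (ofPiCHat e C μ hC hS hl hp2 hpl hζ hη hZ hN T) Cu (StableCurveTemperedData.ofSpecialFibre (M.toTemperedCurve.ofOpenSubgroup (M.GtpXu l) (M.toThetaSetting.isOpen_GtpXu l) M.K (range_aug_GtpXu_eq_GK C) hDopen) d Sf h36 Sigma SigmaHat hsub hne hprime hp TpH HatH hle cuspMeetsH)),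
      IsHomeomorph A.eHat ∧
      (∀ x : T.Xplain,
        A.eHat ⟨(ofPiCHat e C μ hC hS hl hp2 hpl hζ hη hZ hN T).emb x, (ofPiCHat e C μ hC hS hl hp2 hpl hζ hη hZ hN T).emb_le_pmHat ⟨x, rfl⟩⟩ = (StableCurveTemperedData.ofSpecialFibre (M.toTemperedCurve.ofOpenSubgroup (M.GtpXu l) (M.toThetaSetting.isOpen_GtpXu l) M.K (range_aug_GtpXu_eq_GK C) hDopen) d Sf h36 Sigma SigmaHat hsub hne hprime hp TpH HatH hle cuspMeetsH).ιX (T.plainIso x)) ∧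
      (∀ (Q I : Subgroup (ofPiCHat e C μ hC hS hl hp2 hpl hζ hη hZ hN T).Corhat), Cu.IsCuspidalInertia Q I ↔
        I ≤ Q ∧ ∃ I₀, Cu.IsCuspidalInertia (ofPiCHat e C μ hC hS hl hp2 hpl hζ hη hZ hN T).piPM I₀ ∧ I = I₀ ⊓ Q) ∧
      ∀ {L : LabCuspStructure Cu} (Ld : LabelledDecomposition Dec L),
        (StableCurveTemperedData.ofSpecialFibre (M.toTemperedCurve.ofOpenSubgroup (M.GtpXu l) (M.toThetaSetting.isOpen_GtpXu l) M.K (range_aug_GtpXu_eq_GK C) hDopen) d Sf h36 Sigma SigmaHat hsub hne hprime hp TpH HatH hle cuspMeetsH).Prop24i →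
        ∀ {I : Subgroup (ofPiCHat e C μ hC hS hl hp2 hpl hζ hη hZ hN T).Corhat},
          Cu.IsCuspidalInertia (ofPiCHat e C μ hC hS hl hp2 hpl hζ hη hZ hN T).piV I → I ≤ (ofPiCHat e C μ hC hS hl hp2 hpl hζ hη hZ hN T).aug.ker →
          (∀ H : Subgroup P, Cor24_family Dec Ld H →
            ∃ (TpH' : Subgroup Sf.chart.G) (HatH' : Subgroup (TemperedGraphGroupData.exists_completion_of_prop36 Sf.Gc h36 Sf.chart).choose)
              (hle' : TpH'.map (TemperedGraphGroupData.exists_completion_of_prop36 Sf.Gc h36 Sf.chart).choose_spec.choose.toMonoidHom ≤ HatH')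
              (cMH' : {x : (M.toTemperedCurve.ofOpenSubgroup (M.GtpXu l) (M.toThetaSetting.isOpen_GtpXu l) M.K (range_aug_GtpXu_eq_GK C) hDopen).Pt // (M.toTemperedCurve.ofOpenSubgroup (M.GtpXu l) (M.toThetaSetting.isOpen_GtpXu l) M.K (range_aug_GtpXu_eq_GK C) hDopen).IsCusp x} → Prop),
              (((StableCurveTemperedData.ofSpecialFibre (M.toTemperedCurve.ofOpenSubgroup (M.GtpXu l) (M.toThetaSetting.isOpen_GtpXu l) M.K (range_aug_GtpXu_eq_GK C) hDopen) d Sf h36 Sigma SigmaHat hsub hne hprime hp TpH' HatH' hle' cMH').graph.HatH : Set (StableCurveTemperedData.ofSpecialFibre (M.toTemperedCurve.ofOpenSubgroup (M.GtpXu l) (M.toThetaSetting.isOpen_GtpXu l) M.K (range_aug_GtpXu_eq_GK C) hDopen) d Sf h36 Sigma SigmaHat hsub hne hprime hp TpH' HatH' hle' cMH').graph.Hat) = closure ((StableCurveTemperedData.ofSpecialFibre (M.toTemperedCurve.ofOpenSubgroup (M.GtpXu l) (M.toThetaSetting.isOpen_GtpXu l) M.K (range_aug_GtpXu_eq_GK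 C) hDopen) d Sf h36 Sigma SigmaHat hsub hne hprime hp TpH' HatH' hle' cMH').graph.ι '' (StableCurveTemperedData.ofSpecialFibre (M.toTemperedCurve.ofOpenSubgroup (M.GtpXu l) (M.toThetaSetting.isOpen_GtpXu l) M.K (range_aug_GtpXu_eq_GK C) hDopen) d Sf h36 Sigma SigmaHat hsub hne hprime hp TpH' HatH' hle' cMH').graph.TpH)) ∧
              H = (((StableCurveTemperedData.ofSpecialFibre (M.toTemperedCurve.ofOpenSubgroup (M.GtpXu l) (M.toThetaSetting.isOpen_GtpXu l) M.K (range_aug_GtpXu_eq_GK C) hDopen) d Sf h36 Sigma SigmaHat hsub hne hprime hp TpH' HatH' hle' cMH').piTpXH.comap T.plainIso.toMulEquiv.toMonoidHom).comap T.incl) ∧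
              (StableCurveTemperedData.ofSpecialFibre (M.toTemperedCurve.ofOpenSubgroup (M.GtpXu l) (M.toThetaSetting.isOpen_GtpXu l) M.K (range_aug_GtpXu_eq_GK C) hDopen) d Sf h36 Sigma SigmaHat hsub hne hprime hp TpH' HatH' hle' cMH').Cor23Hyp ∧ (StableCurveTemperedData.ofSpecialFibre (M.toTemperedCurve.ofOpenSubgroup (M.GtpXu l) (M.toThetaSetting.isOpen_GtpXu l) M.K (range_aug_GtpXu_eq_GK C) hDopen) d Sf h36 Sigma SigmaHat hsub hne hprime hp TpH' HatH' hle' cMH').Cor23iii ∧ (StableCurveTemperedData.ofSpecialFibre (M.toTemperedCurve.ofOpenSubgroup (M.GtpXu l) (M.toThetaSetting.isOpen_GtpXu l) M.K (range_aug_GtpXu_eq_GK C) hDopen) d Sf h36 Sigma SigmaHat hsub hne hprime hp TpH' HatH' hle' cMH').Cor23iv ∧ (StableCurveTemperedData.ofSpecialFibre (M.toTemperedCurve.ofOpenSubgroup (M.GtpXu l) (M.toThetaSetting.isOpen_GtpXu l) M.K (range_aug_GtpXu_eq_GK C) hDopen) d Sf h36 Sigma SigmaHat hsub hne hprime hp TpH'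 HatH' hle' cMH').Cor23v) →
          (∀ H : Subgroup P, Cor24_family Dec Ld H → ∀ γ' : (ofPiCHat e C μ hC hS hl hp2 hpl hζ hη hZ hN T).Corhat,
              γ' ∈ (ofPiCHat e C μ hC hS hl hp2 hpl hζ hη hZ hN T).piPM ⊓ (ofPiCHat e C μ hC hS hl hp2 hpl hζ hη hZ hN T).aug.ker →
              I.map (MulAut.conj γ').toMonoidHom ≤ (ofPiCHat e C μ hC hS hl hp2 hpl hζ hη hZ hN T).pmBox H →
              γ' ∈ closure ((ofPiCHat e C μ hC hS hl hp2 hpl hζ hη hZ hN T).deltaPmBox H : Set (ofPiCHat e C μ hC hS hl hp2 hpl hζ hη hZ hN T).Corhat)) →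
          Literature.IUT.HodgeArakelov.Cor24_i' Dec (ofPiCHat e C μ hC hS hl hp2 hpl hζ hη hZ hN T) Cu Ld I := by
  obtain ⟨Cu, A, hhomeo, hA, hlev⟩ := exists_stableCurveAgreement_ofPiCHat_ofSpecialFibre_isHomeomorph e C μ hC hS hl hp2 hpl hζ hη hZ hN T
    hDopen d Sf h36 Sigma SigmaHat hsub hne hprime hp TpH HatH hle cuspMeetsH
  refine ⟨Cu, A, hhomeo, hA, hlev, fun Ld h24i I hI hIker Ident h23vi H hH => ?_⟩
  obtain ⟨TpH', HatH', hle', cMH', hH', hHeq, hHyp', h23iii', h23iv', h23v'⟩ := Ident H hH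
  have h23vi' := h23vi H hH
  rw [hHeq] at h23vi' ⊢
  exact A.cor24_i_ofSpecialFibre_comap hlev hhomeo T.plainIso.toMulEquiv hA
    (range_incl_normal_ofUnderline C μ hC hS hl hp2 hpl hζ hη hN T)
    (index_range_incl_ne_zero_ofUnderline C μ hC hS hl hp2 hpl hζ hη T) h24i hI hIker TpH' HatH' hle' cMH' hH'
    hHyp' h23iii' h23iv' h23v' h23vi'

end PlusMinusTower

end Literature.IUT.HodgeArakelov

end
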